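import Summits.Ventures.QEC.CircuitDistance.PortKinds
import HarnessLib

/-!
# P3-PORT (E1b): the sector column of a fault is the column of its sector-kind representative (cell `qec`, experiment CDX,
# seat qec-cdx-type-1)

`xColumn_eq_of_xHalf`, **`xColumn_eq_of_xKind`** (the `Z`-check detectors and the residual `X`-error of any fault of the
circuit are those of `k.fault f.cyc i` for `f.xKind = some (k, i)`), **`xColumn_zero_of_xKind`** (and zero for
`f.xKind = none`), with the `Z` mirrors.  This is what lets a 42-row table per code describe every column.  Generic in `S`.
-/

namespace Summit.Ventures.QEC.CircuitDistance

open Literature.InformationTheory.QuantumCodes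

variable {ℓ m : ℕ} [NeZero ℓ] [NeZero m]

/-- The `X`-sector column of a fault is determined by the `X`-half of its run. -/
theorem xColumn_eq_of_xHalf (S : SMCode ℓ m) (Nc : ℕ) {f g : Fault ℓ m} (h : (run1 S Nc f).xHalf = (run1 S Nc g).xHalf) :
    (∀ t j, detZ S Nc {f} t j = detZ S Nc {g} t j) ∧ dataX S Nc {f} = dataX S Nc {g} := by
  have hf : ∀ q, ((run1 S Nc f).frame q).1 = ((run1 S Nc g).frame q).1 := fun q => congrFun (congrArg Prod.fst h) q
  have hm : (run1 S Nc f).mZ = (run1 S Nc g).mZ := congrArg Prod.snd h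
  have hd : dataX S Nc {f} = dataX S Nc {g} := by
    rw [dataX_singleton_run1, dataX_singleton_run1]; congr 1; funext q; exact hf _
  refine ⟨fun t j => ?_, hd⟩
  unfold detZ; simp only [flipZ_singleton, hm, hd]

/-- Mirror. -/
theorem zColumn_eq_of_zHalf (S : SMCode ℓ m) (Nc : ℕ) {f g : Fault ℓ m} (h : (run1 S Nc f).zHalf = (run1 S Nc g).zHalf) :
    (∀ t i, detX S Nc {f} t i = detX S Nc {g} t i) ∧ dataZ S Nc {f} = dataZ S Nc {g} := by
  have hf : ∀ q, ((run1 S Nc f).frame q).2 = ((run1 S Nc g).frame q).2 := fun q => congrFun (congrArg Prod.fst h) q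
  have hm : (run1 S Nc f).mX = (run1 S Nc g).mX := congrArg Prod.snd h
  have hd : dataZ S Nc {f} = dataZ S Nc {g} := by
    rw [dataZ_singleton_run1, dataZ_singleton_run1]; congr 1; funext q; exact hf _
  refine ⟨fun t i => ?_, hd⟩
  unfold detX; simp only [flipX_singleton, hm, hd]

/-- **x/z-INDEPENDENCE.** The `X`-sector column of a fault is that of its `X`-kind representative … -/
theorem xColumn_eq_of_xKind (S : SMCode ℓ m) (Nc : ℕ) (f : Fault ℓ m) {k : XKind} {i : BB.Mono ℓ m}
    (h : f.xKind = some (k, i)) :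
    (∀ t j, detZ S Nc {f} t j = detZ S Nc {k.fault f.cyc i} t j) ∧ dataX S Nc {f} = dataX S Nc {k.fault f.cyc i} := by
  apply xColumn_eq_of_xHalf
  unfold run1
  apply xHalf_simulate S (Fault.ev_xKind h)
  · intro st st' hst
    have hfr : ∀ q, (st.frame q).1 = (st'.frame q).1 := fun q => congrFun (congrArg Prod.fst hst) q
    have hm : st.mZ = st'.mZ := congrArg Prod.snd hst
    cases f with
    | cnot c lay i' pc pt =>
      simp only [Fault.xKind] at h
      split_ifs at h with hb
      obtain ⟨rfl, rfl⟩ := Prod.mk.inj (Option.some_injective _ h)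
      simp only [inject, XKind.fault, State.xHalf, Fault.cyc, Prod.mk.injEq]
      refine ⟨?_, hm⟩
      funext q; simp only [Frame.mulAt, P1.mul_def]; split_ifs <;> simp [hfr]
    | idle c s i' p =>
      simp only [Fault.xKind] at h
      split_ifs at h with hb
      obtain ⟨rfl, rfl⟩ := Prod.mk.inj (Option.some_injective _ h)
      simp only [inject, XKind.fault, State.xHalf, Fault.cyc, Prod.mk.injEq]
      refine ⟨?_, hm⟩
      funext q; simp only [Frame.mulAt, P1.mul_def]; split_ifs <;> simp [hfr, hb]
    | initX c i' => simp [Fault.xKind] at h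
    | measX c i' => simp [Fault.xKind] at h
    | initZ c i' =>
      simp only [Fault.xKind, Option.some.injEq, Prod.mk.injEq] at h
      obtain ⟨rfl, rfl⟩ := h
      simp only [inject, XKind.fault, State.xHalf, Fault.cyc, Prod.mk.injEq]
      refine ⟨?_, hm⟩
      funext q; simp only [Frame.mulAt, P1.mul_def]; split_ifs <;> simp [hfr]
    | measZ c i' =>
      simp only [Fault.xKind, Option.some.injEq, Prod.mk.injEq] at h
      obtain ⟨rfl, rfl⟩ := h
      simp only [inject, XKind.fault, State.xHalf, Fault.cyc, Prod.mk.injEq]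
      refine ⟨funext fun q => hfr q, ?_⟩
      funext c' j; rw [hm]
  · rfl

/-- … and zero if the fault has no `X`-part. -/
theorem xColumn_zero_of_xKind (S : SMCode ℓ m) (Nc : ℕ) (f : Fault ℓ m) (h : f.xKind = none) :
    (∀ t j, detZ S Nc {f} t j = false) ∧ dataX S Nc {f} = 0 := by
  have hx : (run1 S Nc f).xHalf = (State.init : State ℓ m).xHalf := by
    unfold run1
    conv_rhs => rw [← evolve_init S (allEvents Nc)]
    apply xHalf_simulate_none S _ (allEvents Nc) rfl
    intro st
    cases f with
    | cnot c lay i' pc pt =>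
      simp only [Fault.xKind] at h
      split_ifs at h with hb
      simp only [Bool.or_eq_true, not_or, Bool.not_eq_true] at hb
      simp only [inject, State.xHalf, Prod.mk.injEq, and_true]
      funext q; simp only [Frame.mulAt, P1.mul_def]; split_ifs <;> simp [hb]
    | idle c s i' p =>
      simp only [Fault.xKind] at h
      split_ifs at h with hb
      simp only [Bool.not_eq_true] at hb
      simp only [inject, State.xHalf, Prod.mk.injEq, and_true]
      funext q; simp only [Frame.mulAt, P1.mul_def]; split_ifs <;> simp [hb]
    | initX c i' =>
      simp only [inject, State.xHalf, Prod.mk.injEq, and_true]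
      funext q; simp only [Frame.mulAt, P1.mul_def]; split_ifs <;> simp
    | measX c i' => rfl
    | initZ c i' => simp [Fault.xKind] at h
    | measZ c i' => simp [Fault.xKind] at h
  have hfq : ∀ q, ((run1 S Nc f).frame q).1 = false := fun q => congrFun (congrArg Prod.fst hx) q
  have hd : dataX S Nc {f} = 0 := by
    rw [dataX_singleton_run1]; funext q; unfold toZ2 Frame.dataXb
    rw [hfq]; rfl
  refine ⟨fun t j => ?_, hd⟩
  have hm : (run1 S Nc f).mZ = fun _ _ => false := congrArg Prod.snd hx
  unfold detZ; simp only [flipZ_singleton, hm, hd, Matrix.mulVec_zero]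
  simp

/-- `Z` mirror of `xColumn_eq_of_xKind`. -/
theorem zColumn_eq_of_zKind (S : SMCode ℓ m) (Nc : ℕ) (f : Fault ℓ m) {k : ZKind} {i : BB.Mono ℓ m}
    (h : f.zKind = some (k, i)) :
    (∀ t i', detX S Nc {f} t i' = detX S Nc {k.fault f.cyc i} t i') ∧ dataZ S Nc {f} = dataZ S Nc {k.fault f.cyc i} := by
  apply zColumn_eq_of_zHalf
  unfold run1
  apply zHalf_simulate S (Fault.ev_zKind h)
  · intro st st' hst
    have hfr : ∀ q, (st.frame q).2 = (st'.frame q).2 := fun q => congrFun (congrArg Prod.fst hst) q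
    have hm : st.mX = st'.mX := congrArg Prod.snd hst
    cases f with
    | cnot c lay i' pc pt =>
      simp only [Fault.zKind] at h
      split_ifs at h with hb
      obtain ⟨rfl, rfl⟩ := Prod.mk.inj (Option.some_injective _ h)
      simp only [inject, ZKind.fault, State.zHalf, Fault.cyc, Prod.mk.injEq]
      refine ⟨?_, hm⟩
      funext q; simp only [Frame.mulAt, P1.mul_def]; split_ifs <;> simp [hfr]
    | idle c s i' p =>
      simp only [Fault.zKind] at h
      split_ifs at h with hb
      obtain ⟨rfl, rfl⟩ := Prod.mk.inj (Option.some_injective _ h)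
      simp only [inject, ZKind.fault, State.zHalf, Fault.cyc, Prod.mk.injEq]
      refine ⟨?_, hm⟩
      funext q; simp only [Frame.mulAt, P1.mul_def]; split_ifs <;> simp [hfr, hb]
    | initZ c i' => simp [Fault.zKind] at h
    | measZ c i' => simp [Fault.zKind] at h
    | initX c i' =>
      simp only [Fault.zKind, Option.some.injEq, Prod.mk.injEq] at h
      obtain ⟨rfl, rfl⟩ := h
      simp only [inject, ZKind.fault, State.zHalf, Fault.cyc, Prod.mk.injEq]
      refine ⟨?_, hm⟩
      funext q; simp only [Frame.mulAt, P1.mul_def]; split_ifs <;> simp [hfr]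
    | measX c i' =>
      simp only [Fault.zKind, Option.some.injEq, Prod.mk.injEq] at h
      obtain ⟨rfl, rfl⟩ := h
      simp only [inject, ZKind.fault, State.zHalf, Fault.cyc, Prod.mk.injEq]
      refine ⟨funext fun q => hfr q, ?_⟩
      funext c' j; rw [hm]
  · rfl

/-- `Z` mirror of `xColumn_zero_of_xKind`. -/
theorem zColumn_zero_of_zKind (S : SMCode ℓ m) (Nc : ℕ) (f : Fault ℓ m) (h : f.zKind = none) :
    (∀ t i, detX S Nc {f} t i = false) ∧ dataZ S Nc {f} = 0 := by
  have hx : (run1 S Nc f).zHalf = (State.init : State ℓ m).zHalf := by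
    unfold run1
    conv_rhs => rw [← evolve_init S (allEvents Nc)]
    apply zHalf_simulate_none S _ (allEvents Nc) rfl
    intro st
    cases f with
    | cnot c lay i' pc pt =>
      simp only [Fault.zKind] at h
      split_ifs at h with hb
      simp only [Bool.or_eq_true, not_or, Bool.not_eq_true] at hb
      simp only [inject, State.zHalf, Prod.mk.injEq, and_true]
      funext q; simp only [Frame.mulAt, P1.mul_def]; split_ifs <;> simp [hb]
    | idle c s i' p =>
      simp only [Fault.zKind] at h
      split_ifs at h with hb
      simp only [Bool.not_eq_true] at hb
      simp only [inject, State.zHalf, Prod.mk.injEq, and_true]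
      funext q; simp only [Frame.mulAt, P1.mul_def]; split_ifs <;> simp [hb]
    | initZ c i' =>
      simp only [inject, State.zHalf, Prod.mk.injEq, and_true]
      funext q; simp only [Frame.mulAt, P1.mul_def]; split_ifs <;> simp
    | measZ c i' => rfl
    | initX c i' => simp [Fault.zKind] at h
    | measX c i' => simp [Fault.zKind] at h
  have hfq : ∀ q, ((run1 S Nc f).frame q).2 = false := fun q => congrFun (congrArg Prod.fst hx) q
  have hd : dataZ S Nc {f} = 0 := by
    rw [dataZ_singleton_run1]; funext q; unfold toZ2 Frame.dataZb
    rw [hfq]; rfl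
  refine ⟨fun t i => ?_, hd⟩
  have hm : (run1 S Nc f).mX = fun _ _ => false := congrArg Prod.snd hx
  unfold detX; simp only [flipX_singleton, hm, hd, Matrix.mulVec_zero]
  simp

end Summit.Ventures.QEC.CircuitDistance
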